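import Mathlib.Analysis.SpecialFunctions.Pow.Real
import Mathlib.Analysis.SpecialFunctions.Log.Basic
import Mathlib.Analysis.SpecificLimits.Basic
import HarnessLib

/-!
# The oscillation iteration lemma (Gilbarg–Trudinger, Lemma 8.23)

The elementary real-variable lemma behind the De Giorgi–Nash–Moser, Krylov–Safonov and
Evans–Krylov Hölder estimates: a non-decreasing `ω` on `(0, R₀]` with
`ω(τR) ≤ γ ω(R) + σ(R)` (`σ` non-decreasing, `0 < γ, τ < 1`) satisfies, for every `μ ∈ (0,1)`
and `R ≤ R₀`,
`ω(R) ≤ C((R/R₀)^α ω(R₀) + σ(R^μ R₀^{1−μ}))`, `C = C(γ, τ)`, `α = α(γ, τ, μ) > 0`.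
We prove it with the explicit constants of the printed proof,
`C = max(1/γ, 1/(1−γ))` (here: the two terms carry `1/γ` and `1/(1−γ)` respectively) and
`α = (1 − μ) log γ / log τ`.

* `GilbargTrudinger.oscillation_iterate` — the iterated inequality
  `ω(τ^m R₁) ≤ γ^m ω(R₁) + σ(R₁) Σ_{i<m} γ^i`;
* `GilbargTrudinger.oscillation_lemma` — Lemma 8.23 (with `ω(R₀) ≥ 0` and `σ ≥ 0`, as for an
  oscillation and `σ(R) = cR^δ` in every application).

Vendored as the first elementary ingredient of the Evans–Krylov theorem (Thm. 17.14) needed by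
`Literature.Geometry.Riemannian.gurskyViaclovsky_pathClosed_weighted_four`.

## References

* D. Gilbarg, N. S. Trudinger, *Elliptic Partial Differential Equations of Second Order*,
  Classics in Mathematics, Springer (2001), Lemma 8.23, pp. 201–202. [GilbargTrudinger2001]
-/

noncomputable section

open Set Finset Real

namespace Literature.Analysis.PDE.GilbargTrudinger

/-- **The iterated inequality** of the proof of Lemma 8.23: if `ω(τR) ≤ γ ω(R) + σ(R₁)` for all
`R ∈ (0, R₁]` with `0 ≤ γ`, `0 < τ ≤ 1`, then `ω(τ^m R₁) ≤ γ^m ω(R₁) + σ₁ Σ_{i<m} γ^i`.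
[cite: GilbargTrudinger2001, Lemma 8.23 (proof)] -/
theorem oscillation_iterate {ω : ℝ → ℝ} {R₁ γ τ σ₁ : ℝ} (hR₁ : 0 < R₁) (hγ0 : 0 ≤ γ)
    (hτ0 : 0 < τ) (hτ1 : τ ≤ 1)
    (h : ∀ R ∈ Ioc 0 R₁, ω (τ * R) ≤ γ * ω R + σ₁) (m : ℕ) :
    ω (τ ^ m * R₁) ≤ γ ^ m * ω R₁ + σ₁ * ∑ i ∈ range m, γ ^ i := by
  induction m with
  | zero => simp
  | succ m ih =>
    have hmem : τ ^ m * R₁ ∈ Ioc 0 R₁ :=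
      ⟨mul_pos (pow_pos hτ0 m) hR₁, by
        calc τ ^ m * R₁ ≤ 1 * R₁ :=
              mul_le_mul_of_nonneg_right (pow_le_one₀ hτ0.le hτ1) hR₁.le
          _ = R₁ := one_mul _⟩
    have hstep := h _ hmem
    rw [← mul_assoc, ← pow_succ'] at hstep
    have hs : ∑ i ∈ range (m + 1), γ ^ i = γ * ∑ i ∈ range m, γ ^ i + 1 := by
      rw [Finset.sum_range_succ', pow_zero, Finset.mul_sum]
      simp only [pow_succ']
    calc ω (τ ^ (m + 1) * R₁) ≤ γ * ω (τ ^ m * R₁) + σ₁ := hstep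
      _ ≤ γ * (γ ^ m * ω R₁ + σ₁ * ∑ i ∈ range m, γ ^ i) + σ₁ := by
          gcongr
      _ = γ ^ (m + 1) * ω R₁ + σ₁ * ∑ i ∈ range (m + 1), γ ^ i := by
          rw [hs, pow_succ']
          ring

/-- **Gilbarg–Trudinger, Lemma 8.23 (oscillation iteration lemma)**, with explicit constants.
Let `ω` be non-decreasing on `(0, R₀]` with `ω(R₀) ≥ 0` and `ω(τR) ≤ γ ω(R) + σ(R)` for all
`R ≤ R₀`, where `σ ≥ 0` is non-decreasing and `0 < γ < 1`, `0 < τ < 1`. Then for `μ ∈ (0,1)`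
and `0 < R ≤ R₀`:
`ω(R) ≤ (1/γ)(R/R₀)^{(1−μ) log γ/ log τ} ω(R₀) + σ(R^μ R₀^{1−μ})/(1 − γ)`
(the printed `C((R/R₀)^α ω(R₀) + σ(R^μR₀^{1−μ}))` with `C = max(1/γ, 1/(1−γ))`,
`α = (1−μ) log γ / log τ > 0`; in the applications `ω` is an oscillation and `σ(R) = c R^δ`,
whence the sign hypotheses). [cite: GilbargTrudinger2001, Lemma 8.23, pp. 201–202] -/
theorem oscillation_lemma {ω σ : ℝ → ℝ} {R₀ γ τ μ : ℝ} (hR₀ : 0 < R₀) (hγ0 : 0 < γ)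
    (hγ1 : γ < 1) (hτ0 : 0 < τ) (hτ1 : τ < 1) (hμ0 : 0 < μ) (hμ1 : μ < 1)
    (hω : MonotoneOn ω (Ioc 0 R₀)) (hσ : MonotoneOn σ (Ioc 0 R₀))
    (hσ0 : ∀ r ∈ Ioc 0 R₀, 0 ≤ σ r) (hω0 : 0 ≤ ω R₀)
    (h : ∀ R ∈ Ioc 0 R₀, ω (τ * R) ≤ γ * ω R + σ R) {R : ℝ} (hR : R ∈ Ioc 0 R₀) :
    ω R ≤ 1 / γ * (R / R₀) ^ ((1 - μ) * (Real.log γ / Real.log τ)) * ω R₀ +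
      1 / (1 - γ) * σ (R ^ μ * R₀ ^ (1 - μ)) := by
  obtain ⟨hR0, hRR₀⟩ := hR
  -- the intermediate radius `R₁ = R^μ R₀^{1−μ}`, `R ≤ R₁ ≤ R₀`
  set R₁ : ℝ := R ^ μ * R₀ ^ (1 - μ) with hR₁_def
  have hR₁0 : 0 < R₁ := mul_pos (rpow_pos_of_pos hR0 μ) (rpow_pos_of_pos hR₀ _)
  have hRμ : R ^ μ ≤ R₀ ^ μ := rpow_le_rpow hR0.le hRR₀ hμ0.le
  have hR₁R₀ : R₁ ≤ R₀ := by
    calc R₁ ≤ R₀ ^ μ * R₀ ^ (1 - μ) :=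
          mul_le_mul_of_nonneg_right hRμ (rpow_nonneg hR₀.le _)
      _ = R₀ := by rw [← rpow_add hR₀, add_sub_cancel, rpow_one]
  have hRR₁ : R ≤ R₁ := by
    have h1 : R ^ (1 - μ) ≤ R₀ ^ (1 - μ) := rpow_le_rpow hR0.le hRR₀ (by linarith)
    calc R = R ^ μ * R ^ (1 - μ) := by rw [← rpow_add hR0, add_sub_cancel, rpow_one]
      _ ≤ R ^ μ * R₀ ^ (1 - μ) := mul_le_mul_of_nonneg_left h1 (rpow_nonneg hR0.le _)
  have hR₁mem : R₁ ∈ Ioc 0 R₀ := ⟨hR₁0, hR₁R₀⟩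
  -- the frozen inequality on `(0, R₁]` and its iteration
  have h' : ∀ R' ∈ Ioc 0 R₁, ω (τ * R') ≤ γ * ω R' + σ R₁ := fun R' hR' ↦ by
    have hR'mem : R' ∈ Ioc 0 R₀ := ⟨hR'.1, hR'.2.trans hR₁R₀⟩
    exact (h R' hR'mem).trans (by linarith [hσ hR'mem hR₁mem hR'.2])
  have hiter := oscillation_iterate (ω := ω) hR₁0 hγ0.le hτ0 hτ1.le h'
  -- choose `m = k + 1 ≥ 1` minimal with `τ^m R₁ < R`; then `R ≤ τ^k R₁`
  have hex : ∃ m : ℕ, τ ^ m * R₁ < R := by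
    obtain ⟨m, hm⟩ := exists_pow_lt_of_lt_one (div_pos hR0 hR₁0) hτ1
    exact ⟨m, by rwa [lt_div_iff₀ hR₁0] at hm⟩
  classical
  set m := Nat.find hex with hm_def
  have hm : τ ^ m * R₁ < R := Nat.find_spec hex
  have hm0 : m ≠ 0 := by
    intro h0
    rw [h0, pow_zero, one_mul] at hm
    linarith
  obtain ⟨k, hk⟩ := Nat.exists_eq_succ_of_ne_zero hm0
  have hk' : ¬ (τ ^ k * R₁ < R) :=
    Nat.find_min hex (by rw [← hm_def, hk]; exact Nat.lt_succ_self k)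
  have hRk : R ≤ τ ^ k * R₁ := le_of_not_gt hk'
  have hkmem : τ ^ k * R₁ ∈ Ioc 0 R₀ :=
    ⟨mul_pos (pow_pos hτ0 k) hR₁0, by
      calc τ ^ k * R₁ ≤ 1 * R₁ := mul_le_mul_of_nonneg_right (pow_le_one₀ hτ0.le hτ1.le) hR₁0.le
        _ = R₁ := one_mul _
        _ ≤ R₀ := hR₁R₀⟩
  -- `ω R ≤ ω(τ^k R₁) ≤ γ^k ω(R₀) + σ(R₁)/(1-γ)`
  have hgeom : ∑ i ∈ range k, γ ^ i ≤ 1 / (1 - γ) := by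
    rw [geom_sum_eq hγ1.ne k]
    have h1 : (γ ^ k - 1) / (γ - 1) = (1 - γ ^ k) / (1 - γ) := by
      rw [← neg_sub 1 (γ ^ k), ← neg_sub 1 γ, neg_div_neg_eq]
    rw [h1]
    exact div_le_div_of_nonneg_right (by linarith [pow_nonneg hγ0.le k]) (by linarith)
  have hωR₁ : ω R₁ ≤ ω R₀ := hω hR₁mem ⟨hR₀, le_rfl⟩ hR₁R₀
  have hγk : 0 ≤ γ ^ k := pow_nonneg hγ0.le k
  have hσR₁ : 0 ≤ σ R₁ := hσ0 R₁ hR₁mem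
  have h1 : ω R ≤ γ ^ k * ω R₀ + 1 / (1 - γ) * σ R₁ := by
    calc ω R ≤ ω (τ ^ k * R₁) := hω ⟨hR0, hRR₀⟩ hkmem hRk
      _ ≤ γ ^ k * ω R₁ + σ R₁ * ∑ i ∈ range k, γ ^ i := hiter k
      _ ≤ γ ^ k * ω R₀ + σ R₁ * (1 / (1 - γ)) := by gcongr
      _ = γ ^ k * ω R₀ + 1 / (1 - γ) * σ R₁ := by ring
  -- `γ^k ≤ (1/γ)(R/R₁)^{log γ / log τ}`
  have hlogτ : Real.log τ < 0 := Real.log_neg hτ0 hτ1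
  have hlogγ : Real.log γ < 0 := Real.log_neg hγ0 hγ1
  have hratio : 0 < R / R₁ := div_pos hR0 hR₁0
  have hmlog : (m : ℝ) * Real.log τ < Real.log (R / R₁) := by
    have h0 : 0 < τ ^ m * R₁ := mul_pos (pow_pos hτ0 m) hR₁0
    have := Real.log_lt_log h0 hm
    rw [Real.log_mul (pow_pos hτ0 m).ne' hR₁0.ne', Real.log_pow] at this
    rw [Real.log_div hR0.ne' hR₁0.ne']
    linarith
  have hγm : γ ^ m ≤ (R / R₁) ^ (Real.log γ / Real.log τ) := by
    rw [← Real.rpow_natCast, Real.rpow_def_of_pos hγ0, Real.rpow_def_of_pos hratio]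
    apply Real.exp_le_exp.2
    have hm' : Real.log (R / R₁) / Real.log τ < (m : ℝ) := by
      rwa [div_lt_iff_of_neg hlogτ]
    calc Real.log γ * (m : ℝ) ≤ Real.log γ * (Real.log (R / R₁) / Real.log τ) :=
          mul_le_mul_of_nonpos_left hm'.le hlogγ.le
      _ = Real.log (R / R₁) * (Real.log γ / Real.log τ) := by
          field_simp
  have hγk1 : γ ^ k ≤ 1 / γ * (R / R₁) ^ (Real.log γ / Real.log τ) := by
    have : γ ^ m = γ * γ ^ k := by rw [hk, pow_succ']
    rw [this] at hγm
    rw [one_div, le_inv_mul_iff₀ hγ0]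
    exact hγm
  -- `R / R₁ = (R / R₀)^{1-μ}` and the exponent algebra
  have hRR₁eq : R / R₁ = (R / R₀) ^ (1 - μ) := by
    rw [hR₁_def, div_rpow hR0.le hR₀.le, div_eq_div_iff hR₁0.ne' (rpow_pos_of_pos hR₀ _).ne']
    calc R * R₀ ^ (1 - μ) = (R ^ μ * R ^ (1 - μ)) * R₀ ^ (1 - μ) := by
          rw [← rpow_add hR0, add_sub_cancel, rpow_one]
      _ = R ^ (1 - μ) * (R ^ μ * R₀ ^ (1 - μ)) := by ring
  have hpow : (R / R₁) ^ (Real.log γ / Real.log τ) =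
      (R / R₀) ^ ((1 - μ) * (Real.log γ / Real.log τ)) := by
    rw [hRR₁eq, ← Real.rpow_mul (div_pos hR0 hR₀).le]
  -- assemble
  calc ω R ≤ γ ^ k * ω R₀ + 1 / (1 - γ) * σ R₁ := h1
    _ ≤ 1 / γ * (R / R₁) ^ (Real.log γ / Real.log τ) * ω R₀ + 1 / (1 - γ) * σ R₁ := by
        gcongr
    _ = 1 / γ * (R / R₀) ^ ((1 - μ) * (Real.log γ / Real.log τ)) * ω R₀ +
          1 / (1 - γ) * σ (R ^ μ * R₀ ^ (1 - μ)) := by rw [hpow]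

end Literature.Analysis.PDE.GilbargTrudinger

end
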